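import Literature.AlgebraicGeometry.AbelianSchemes.AbelianSchemeOverGenericFibreExtension
import Literature.AlgebraicGeometry.AbelianSchemes.PolarizedAbelianSchemeWithLevelBaseChange
import Literature.AlgebraicGeometry.AbelianSchemes.AbelianSchemeOverFibreIdentity
import Literature.AlgebraicGeometry.ModuliOfAbelianVarieties.SiegelAdmissibleOfIsoTriple
import HarnessLib

/-!
# An isomorphism of the generic fibres of two polarised abelian schemes with level structure over a Dedekind
# domain extends to an isomorphism of triples over the base — F-7 (7c) in the moduli currency; and: the dual
# transport `Ĥ_e` commutes with base change

Layer `Literature/AlgebraicGeometry/AbelianSchemes`, namespaces `Literature.AlgebraicGeometry.AbelianSchemes.AbelianSchemeOver.DualPair`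
(§1) and `…PolarizedAbelianSchemeWithLevel` (§2).  THEOREMS ONLY (no definition, no named fact, no instance, no notation;
net Literature debt **0**).

[MumfordFogartyKirwan1994, Ch. 7 §2] constructs the moduli scheme as a quotient `H/PGL(m+1)`; the action must be PROPER
(Ch. 0 §4 Def. 0.10 / Prop. 0.9, p. 16), and in the proof of Prop. 7.6 (pp. 136–138) this comes down, by the valuative
criterion, to: **an isomorphism between the generic fibres of two polarised abelian schemes with level structure over a
discrete valuation ring `R ⊇ ℚ` (both families given over `R`) extends to an isomorphism of the families over `R`** —
because an abelian scheme over `R` is the Néron model of its generic fibre ([BLRNeronModels1990] Prop. 1.2/8;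
[Artin1986NeronModels] Cor. (1.4), p. 215), PROVED in the tree (★ `isNeronModel_of_isProper_of_smooth`) and packaged for
the carrier `AbelianSchemeOver (Spec R)` in ★ `AbelianSchemeOverGenericFibreExtension` (p759272).  This file proves that
statement in the CURRENCY OF THE MODULI FUNCTOR — the tree's triples ★ `PolarizedAbelianSchemeWithLevel g N δ S`
(`(A, (Â, 𝒫), λ, level)`, [MumfordFogartyKirwan1994] Def. 7.2 with the type `δ` of App. 7A and [Deligne1971TravauxShimura]
4.16's symplectic-liftable level) and their pull-back RELATION ★ `IsBaseChangeVia P' P f G Ĝ` (cartesian squares `G : A' → A`,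
`Ĝ : Â' → Â` compatible with the group laws, the Poincaré sheaves `(G × Ĝ)^*𝒫 ≅ 𝒫'`, `λ' ≫ Ĝ = G ≫ λ` and the level
sections; along `𝟙 S` it is «isomorphism of triples», Def. 7.3 p. 129) — for every Dedekind domain `R`:

* §1 `DualPair.eq_hatTransport_baseChange` — **the dual transport commutes with base change**: for an isomorphism of
  `S`-group schemes `e : A' ≅ A` between abelian schemes carrying dual pairs `(Â', 𝒫')`, `(Â, 𝒫)`, a morphism `g : S' → S`,
  and an isomorphism of `S'`-group schemes `ε : A' ×_S S' ≅ A ×_S S'` lying over `e`, every `S'`-morphism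
  `Â' ×_S S' → Â ×_S S'` lying over the dual transport `Ĥ_e : Â' → Â` (★ `DualPair.hatTransport`, the classifying map of
  `(e⁻¹ × 1)^*𝒫'`, [MilneAV2008] I §8) IS the dual transport `Ĥ_ε` of `ε` for the base-changed dual pairs ★ `DualPair.baseChange`
  ([MumfordFogartyKirwan1994] Cor. 6.8: the dual abelian scheme commutes with base change): both classify
  `(ε⁻¹ × 1)^*𝒫'_{S'}`, the pull-back along `pr × pr : A_{S'} ×_{S'} Â'_{S'} → A ×_S Â'` of the defining isomorphism
  `(1 × Ĥ_e)^*𝒫 ≅ (e⁻¹ × 1)^*𝒫'` (★ `nonempty_pullbackP_hatTransport_iso`) giving the classifying property, and the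
  classifying map is unique (★ `DualPair.eq_classify`); `DualPair.hatTransport_pullback_map_left` — the form
  `Ĥ_e ×_S S' = Ĥ_{e ×_S S'}`.
* §2 **`PolarizedAbelianSchemeWithLevel.exists_isBaseChangeVia_id_of_genericFibre`** — THE HEAD: for `R` Dedekind with
  fraction field `K`, `γ : Spec K → Spec R`, and triples `P', P` over `Spec R` whose generic fibres ★ `P'.baseChange γ`,
  `P.baseChange γ` are related along `𝟙 (Spec K)` through `(G_K, Ĝ_K)`, there are an isomorphism of `R`-group schemes
  `f : A' ≅ A` with generic fibre `G_K` and an isomorphism of `R`-group schemes `ĝ : Â' ⟶ Â` with generic fibre `Ĝ_K` such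
  that `P'.IsBaseChangeVia P (𝟙 (Spec R)) f ĝ`; `exists_isBaseChangeVia_id_of_genericFibre'` — the bare form
  `∃ G Ĝ, P'.IsBaseChangeVia P (𝟙 (Spec R)) G Ĝ`.  PROOF (all levers ★): `f` := the Néron extension of the `A`-clause
  isomorphism `e_K` (★ `AbelianSchemeOver.exists_iso_of_isBaseChangeVia_id`, ★ `AbelianSchemeOver.exists_iso_map_genericFibre_eq`);
  `ĝ := Ĥ_f` (★ `DualPair.hatTransportOver`, an isomorphism ★ `isIso_hatTransportOver`) — so the POINCARÉ clause holds by
  construction (★ `DualPair.nonempty_pullback_map_hatTransport_iso`); by §1 the generic fibre of `ĝ` is `Ĥ_{e_K}`, which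
  is `Ĝ_K` by the uniqueness of the dual over `K` (★ `IsBaseChangeVia.hat_eq_hatTransport`); hence `ĝ` is a HOMOMORPHISM
  and the `λ`-CLAUSE holds, both statements being detected on the generic fibre (★ `AbelianSchemeOver.isMonHom_of_isMonHom_genericFibre`,
  ★ `map_genericFibre_injective` — flat source, separated target, [Artin1986NeronModels] (1.1)); the LEVEL clause is
  ★ `LevelStructure.σ_comp_eq_iff_genericFibre`; assembled by ★ `isBaseChangeVia_id_of_isMonHom` /
  `levelStructure_isBaseChangeVia_id_of_isMonHom`.

NOT covered (so nobody over-reads it): (a) both families are GIVEN over `R` — this is extension of ISOMORPHISMS, not of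
objects (no semistable reduction / Néron–Ogg–Shafarevich); (b) the REDUCTION of «the action `PGL × H → H × H` is proper»
to this statement (valuative criterion applied to the embedded families over `H`, [MumfordFogartyKirwan1994] proof of
Prop. 7.6) is the assembly of the cell's F-DAG leaf F-7 (7c) over F-6 and is not done here; (c) an alternative road to the
homomorphism property of `ĝ` over a connected locally Noetherian base is rigidity of the dual transport (B-p03 (g16)'s
`isMonHom_hatTransportOver_of_isLocallyNoetherian`, in flight at the time of writing) — not used.

Cell hodgecm-mathlib (D-0151), fan B, F-DAG capital «F-7 (7c) valuative input in the moduli currency» (B-plan1 (g15) GO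
2026-08-30T03:43:08Z, price pen B-p03 (g16) FIT/NOW 03:43:10Z); typer seat B-typ02 (g14); sequel of ★ p759272.  HC_CM is
proved only modulo the 7 printed citations until rung 0 closes; this file discharges none of them and adds no hypothesis
to anything.

## References
* [MumfordFogartyKirwan1994] D. Mumford, J. Fogarty, F. Kirwan, *Geometric Invariant Theory*, 3rd ed. (1994), Ch. 0 §4
  Prop. 0.9 / Def. 0.10 (p. 16) (proper actions; valuative form), Ch. 6 §1 Cor. 6.8 (p. 118) (the dual abelian scheme and
  base change), Ch. 7 §2 Def. 7.2 / Def. 7.3 (p. 129) (the moduli functor; pull-back and isomorphism of triples),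
  Prop. 7.6 (pp. 136–138) (the quotient; properness of the action).
* [BLRNeronModels1990] S. Bosch, W. Lütkebohmert, M. Raynaud, *Néron Models* (1990), Prop. 1.2/8 (an abelian scheme over
  a Dedekind scheme is the Néron model of its generic fibre).
* [Artin1986NeronModels] M. Artin, *Néron Models*, in Cornell–Silverman (eds.), *Arithmetic Geometry* (1986), §1 (1.1)
  (p. 214), Cor. (1.4) (p. 215).
* [MilneAV2008] J. S. Milne, *Abelian Varieties* (v2.00, 2008), I §8 pp. 36–37 (the dual: universal property, uniqueness
  of the classifying map).
* [Deligne1971TravauxShimura] P. Deligne, *Travaux de Shimura*, Sém. Bourbaki 389 (1971), 4.16 (p. 150) (the moduli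
  functor with symplectic level).
* [GortzWedhorn2020] U. Görtz, T. Wedhorn, *Algebraic Geometry I*, 2nd ed. (2020), Section (4.7) (pp. 107–108) (base change).
* Tree: ★ `AbelianSchemeOverGenericFibreExtension` (p759272), ★ `AbelianSchemeDualTransport` / `…Unique` (`hatTransport`,
  `hatTransportOver`, `nonempty_pullbackP_hatTransport_iso`, `nonempty_pullback_map_hatTransport_iso`,
  `isIso_hatTransportOver`), ★ `AbelianSchemeDualPairBaseChange` (`DualPair.baseChange`), ★ `PolarizedAbelianSchemeWithLevel[BaseChange]`,
  ★ `ModuliOfAbelianVarieties/SiegelAdmissibleOfIsoId` / `…OfIsoTriple` (`exists_iso_of_isBaseChangeVia_id`,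
  `IsBaseChangeVia.hat_eq_hatTransport`), ★ `AbelianSchemeOverFibreIdentity` (`isBaseChangeVia_id_of_isMonHom`,
  `levelStructure_isBaseChangeVia_id_of_isMonHom`).
-/

set_option autoImplicit false

universe u

open CategoryTheory CategoryTheory.Limits AlgebraicGeometry MonoidalCategory
open scoped MonObj CategoryTheory.Obj
open Literature.NumberTheory.EllipticCurves (genericFibre specGenericPoint map_genericFibre_injective)

noncomputable section

namespace Literature.AlgebraicGeometry.AbelianSchemes

namespace AbelianSchemeOver

namespace DualPair

open Literature.AlgebraicGeometry.Motives Literature.AlgebraicGeometry.Modules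

variable {S S' : Scheme.{u}} (g : S' ⟶ S) {A A' : AbelianSchemeOver S} (D : A.DualPair) (D' : A'.DualPair)
  (e : A'.X ≅ A.X) [IsMonHom e.hom]

/-! ## §1 The dual transport commutes with base change -/

/-- **THE DUAL TRANSPORT COMMUTES WITH BASE CHANGE** (core form).  Let `e : A' ≅ A` be an isomorphism of abelian
schemes over `S` (as group schemes) carrying dual pairs `(Â', 𝒫')`, `(Â, 𝒫)`, let `g : S' → S`, and let
`ε : A' ×_S S' ≅ A ×_S S'` be an isomorphism of `S'`-group schemes LYING OVER `e` (`ε ≫ pr = pr ≫ e`; e.g. `e ×_S S'`).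
An `S'`-morphism `Ĥ' : Â' ×_S S' → Â ×_S S'` lying over the dual transport `Ĥ_e : Â' → Â` (`Ĥ' ≫ pr = pr ≫ Ĥ_e`) IS
the dual transport `Ĥ_ε` for the base-changed dual pairs (★ `DualPair.baseChange`; [MumfordFogartyKirwan1994] Cor. 6.8:
formation of the dual commutes with base change): both classify the transported family `(ε⁻¹ × 1)^* 𝒫'_{S'}` on
`A_{S'} ×_{S'} Â'_{S'}` — for `Ĥ'` because `(1 × Ĥ')^* 𝒫_{S'}` and that family are the pull-backs, along the comparison
map `pr × pr : A_{S'} ×_{S'} Â'_{S'} → A ×_S Â'`, of the two sides of the defining isomorphism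
`(1 × Ĥ_e)^*𝒫 ≅ (e⁻¹ × 1)^*𝒫'` of `Ĥ_e` (★ `nonempty_pullbackP_hatTransport_iso`) — so they agree by the uniqueness
half of the universal property of `(Â_{S'}, 𝒫_{S'})` ([MilneAV2008] I §8 «unique»; ★ `DualPair.eq_classify`).
[cite: MilneAV2008, I §8 pp. 36–37] [cite: MumfordFogartyKirwan1994, Ch. 6 §1 Cor. 6.8 (p. 118) and Ch. 7 §2 Definition 7.3 (p. 129)] -/
theorem eq_hatTransport_baseChange (ε : (A'.baseChange g).X ≅ (A.baseChange g).X) [hεm : IsMonHom ε.hom]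
    (hε : ε.hom.left ≫ pullback.fst A.X.hom g = pullback.fst A'.X.hom g ≫ e.hom.left)
    (Ĥ' : (D'.baseChange g).hat.X.left ⟶ (D.baseChange g).hat.X.left)
    (h₁ : Ĥ' ≫ pullback.fst D.hat.X.hom g = pullback.fst D'.hat.X.hom g ≫ hatTransport D D' e)
    (h₂ : Ĥ' ≫ (D.baseChange g).hat.X.hom = (D'.baseChange g).hat.X.hom) :
    Ĥ' = hatTransport (D.baseChange g) (D'.baseChange g) ε := by
  -- `ε⁻¹` lies over `e⁻¹` (from `hε`) and over `S'`
  have h1 : ε.inv.left ≫ ε.hom.left = 𝟙 _ := by rw [← Over.comp_left, Iso.inv_hom_id, Over.id_left]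
  have h2 : e.hom.left ≫ e.inv.left = 𝟙 _ := by rw [← Over.comp_left, Iso.hom_inv_id, Over.id_left]
  have hE : pullback.fst A.X.hom g = ε.inv.left ≫ pullback.fst A'.X.hom g ≫ e.hom.left :=
    ((Category.id_comp _).symm.trans ((congrArg (· ≫ pullback.fst A.X.hom g) h1).symm.trans
      (Category.assoc _ _ _))).trans (congrArg (ε.inv.left ≫ ·) hε)
  have hεinv : ε.inv.left ≫ pullback.fst A'.X.hom g = pullback.fst A.X.hom g ≫ e.inv.left :=
    (((congrArg (ε.inv.left ≫ pullback.fst A'.X.hom g ≫ ·) h2).symm.trans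
      (by simp only [Category.assoc])).trans (congrArg (· ≫ e.inv.left) hE.symm) :)
  have hεS : ε.inv.left ≫ pullback.snd A'.X.hom g = pullback.snd A.X.hom g := Over.w ε.inv
  -- the comparison map `q = pr × pr : A_{S'} ×_{S'} Â'_{S'} → A ×_S Â'` over `g`
  have wA : (A.baseChange g).X.hom ≫ g = pullback.fst A.X.hom g ≫ A.X.hom := pullback.condition.symm
  have wH' : (D'.baseChange g).hat.X.hom ≫ g = pullback.fst D'.hat.X.hom g ≫ D'.hat.X.hom :=
    pullback.condition.symm
  let q : (A.baseChange g).prodLeft (D'.baseChange g).hat ⟶ A.prodLeft D'.hat :=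
    pullback.map _ _ _ _ (pullback.fst A.X.hom g) (pullback.fst D'.hat.X.hom g) g wA wH'
  have hq₁ : q ≫ pullback.fst A.X.hom D'.hat.X.hom =
      pullback.fst (A.baseChange g).X.hom (D'.baseChange g).hat.X.hom ≫ pullback.fst A.X.hom g :=
    pullback.lift_fst _ _ _
  have hq₂ : q ≫ pullback.snd A.X.hom D'.hat.X.hom =
      pullback.snd (A.baseChange g).X.hom (D'.baseChange g).hat.X.hom ≫ pullback.fst D'.hat.X.hom g :=
    pullback.lift_snd _ _ _
  -- square 1: `(1 × Ĥ') ≫ (pr × pr) = q ≫ (1 × Ĥ_e)` into `A ×_S Â` (check the two projections)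
  have sq₁ : (A.baseChange g).baseChangeToProd (D.baseChange g).hat (D'.baseChange g).hat.X.hom Ĥ' h₂ ≫
        D.prodBaseChangeToProd g =
      q ≫ A.baseChangeToProd D.hat D'.hat.X.hom (hatTransport D D' e) (hatTransport_comp_hom D D' e) := by
    apply pullback.hom_ext
    · exact (Category.assoc _ _ _).trans
        ((congrArg (_ ≫ ·) (D.prodBaseChangeToProd_fst g)).trans
          ((Category.assoc _ _ _).symm.trans
            ((congrArg (· ≫ pullback.fst A.X.hom g)
                ((A.baseChange g).baseChangeToProd_fst (D.baseChange g).hat _ Ĥ' h₂)).trans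
              (hq₁.symm.trans
                ((congrArg (q ≫ ·) (A.baseChangeToProd_fst D.hat D'.hat.X.hom _ _)).symm.trans
                  (Category.assoc _ _ _).symm)))))
    · exact (Category.assoc _ _ _).trans
        ((congrArg (_ ≫ ·) (D.prodBaseChangeToProd_snd g)).trans
          ((Category.assoc _ _ _).symm.trans
            ((congrArg (· ≫ pullback.fst D.hat.X.hom g)
                ((A.baseChange g).baseChangeToProd_snd (D.baseChange g).hat _ Ĥ' h₂)).trans
              ((Category.assoc _ _ _).trans
                ((congrArg (pullback.snd (A.baseChange g).X.hom (D'.baseChange g).hat.X.hom ≫ ·) h₁).trans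
                  ((Category.assoc _ _ _).symm.trans
                    ((congrArg (· ≫ hatTransport D D' e) hq₂).symm.trans
                      ((Category.assoc _ _ _).trans
                        ((congrArg (q ≫ ·) (A.baseChangeToProd_snd D.hat D'.hat.X.hom _ _)).symm.trans
                          (Category.assoc _ _ _).symm)))))))))
  -- square 2: `q ≫ (e⁻¹ × 1) = (ε⁻¹ × 1) ≫ (pr × pr)` into `A' ×_S Â'`
  have sq₂ : q ≫ transportMap D' e = transportMap (D'.baseChange g) ε ≫ D'.prodBaseChangeToProd g := by
    apply pullback.hom_ext
    · exact (Category.assoc _ _ _).trans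
        ((congrArg (q ≫ ·) (transportMap_fst D' e)).trans
          ((Category.assoc _ _ _).symm.trans
            ((congrArg (· ≫ e.inv.left) hq₁).trans
              ((Category.assoc _ _ _).trans
                ((congrArg (pullback.fst (A.baseChange g).X.hom (D'.baseChange g).hat.X.hom ≫ ·) hεinv).symm.trans
                  ((Category.assoc _ _ _).symm.trans
                    ((congrArg (· ≫ pullback.fst A'.X.hom g) (transportMap_fst (D'.baseChange g) ε)).symm.trans
                      ((Category.assoc _ _ _).trans
                        ((congrArg (transportMap (D'.baseChange g) ε ≫ ·) (D'.prodBaseChangeToProd_fst g)).symm.trans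
                          (Category.assoc _ _ _).symm)))))))))
    · exact (Category.assoc _ _ _).trans
        ((congrArg (q ≫ ·) (transportMap_snd D' e)).trans
          (hq₂.trans
            ((congrArg (· ≫ pullback.fst D'.hat.X.hom g) (transportMap_snd (D'.baseChange g) ε)).symm.trans
              ((Category.assoc _ _ _).trans
                ((congrArg (transportMap (D'.baseChange g) ε ≫ ·) (D'.prodBaseChangeToProd_snd g)).symm.trans
                  (Category.assoc _ _ _).symm)))))
  -- the defining isomorphism of `Ĥ_e` over `S`, pulled back along `q`
  obtain ⟨i⟩ := nonempty_pullbackP_hatTransport_iso D D' e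
  refine (D.baseChange g).eq_classify (D'.baseChange g).hat.X.hom (transportBundle (D'.baseChange g) ε)
    (transportBundle_fibrewisePicZero (D'.baseChange g) ε) Ĥ' h₂ ⟨?_⟩
  exact (Scheme.Modules.pullbackComp _ _).app D.P ≪≫
    (Scheme.Modules.pullbackCongr sq₁).app D.P ≪≫
    ((Scheme.Modules.pullbackComp _ _).app D.P).symm ≪≫
    (Scheme.Modules.pullback q).mapIso i ≪≫
    (Scheme.Modules.pullbackComp _ _).app D'.P ≪≫
    (Scheme.Modules.pullbackCongr sq₂).app D'.P ≪≫
    ((Scheme.Modules.pullbackComp _ _).app D'.P).symm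

/-- **`Ĥ_e ×_S S' = Ĥ_{e ×_S S'}`**: the base change of the dual transport of `e` is the dual transport of the base change
`e ×_S S' := (Over.pullback g).mapIso e` (a homomorphism for the transported group structures — Mathlib
`Functor.map.instIsMonHom`, recorded inline because instance search does not find it through the carrier's bundled group
law).  [MumfordFogartyKirwan1994] Cor. 6.8: formation of `X̂` commutes with base change.
[cite: MumfordFogartyKirwan1994, Ch. 6 §1 Cor. 6.8 (p. 118) and Ch. 7 §2 Definition 7.3 (p. 129)] [cite: MilneAV2008, I §8 pp. 36–37] -/
theorem hatTransport_pullback_map_left :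
    haveI : @IsMonHom _ _ _ (A'.baseChange g).X (A.baseChange g).X _ _ ((Over.pullback g).mapIso e).hom :=
      Functor.map.instIsMonHom (F := Over.pullback g) (f := e.hom)
    ((Over.pullback g).map (hatTransportOver D D' e)).left =
      hatTransport (D.baseChange g) (D'.baseChange g) ((Over.pullback g).mapIso e) :=
  eq_hatTransport_baseChange g D D' e ((Over.pullback g).mapIso e)
    (hεm := Functor.map.instIsMonHom (F := Over.pullback g) (f := e.hom))
    ((congrArg (· ≫ pullback.fst A.X.hom g) (Over.pullback_map_left g A'.X (k := e.hom))).trans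
      (pullback.lift_fst _ _ _))
    _ ((congrArg (· ≫ pullback.fst D.hat.X.hom g) (Over.pullback_map_left g D'.hat.X (k := hatTransportOver D D' e))).trans
      (pullback.lift_fst _ _ _))
    (Over.w ((Over.pullback g).map (hatTransportOver D D' e)))

end DualPair

end AbelianSchemeOver


/-! ## §2 An isomorphism of triples of the generic fibres extends over a Dedekind base -/

namespace PolarizedAbelianSchemeWithLevel

open AbelianSchemeOver

variable {R : Type u} [CommRing R] [IsDedekindDomain R] (K : Type u) [Field K] [Algebra R K] [IsFractionRing R K]
  {g N : ℕ} {δ : Fin g → ℕ}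

/-- **AN ISOMORPHISM OF THE GENERIC FIBRES OF TWO POLARISED ABELIAN SCHEMES WITH LEVEL STRUCTURE OVER A DEDEKIND DOMAIN
EXTENDS TO AN ISOMORPHISM OF TRIPLES OVER THE BASE.**  Let `R` be a Dedekind domain with field of fractions `K`,
`γ : Spec K → Spec R` the generic point, and `P', P` polarised abelian schemes of type `δ` with symplectic-liftable
level-`N` structure over `Spec R` (★ `PolarizedAbelianSchemeWithLevel`).  If the generic fibres `P' ×_R K`, `P ×_R K`
(★ `PolarizedAbelianSchemeWithLevel.baseChange γ`) are ISOMORPHIC AS TRIPLES — related along `𝟙 (Spec K)` through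
`(G_K, Ĝ_K)` in the sense of the moduli relation ★ `IsBaseChangeVia` ([MumfordFogartyKirwan1994] Def. 7.2 «up to
isomorphism»: cartesian squares compatible with the group laws, the Poincaré sheaves, `λ` and the level sections) —
then `P'` and `P` are isomorphic as triples over `Spec R`: there are an isomorphism of `R`-group schemes `f : A' ≅ A`
with generic fibre `G_K` and an isomorphism of `R`-group schemes `ĝ : Â' ≅ Â` with generic fibre `Ĝ_K` such that
`P'.IsBaseChangeVia P (𝟙 (Spec R)) f ĝ`.  PROOF: `f` is the Néron extension of `G_K` (★ `exists_iso_map_genericFibre_eq`,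
[BLRNeronModels1990] Prop. 1.2/8); `ĝ := Ĥ_f` is the dual transport of `f` (★ `DualPair.hatTransport`, [MilneAV2008] I §8),
so the Poincaré clause holds BY CONSTRUCTION (★ `nonempty_pullback_map_hatTransport_iso`); its generic fibre is the dual
transport of `G_K` (`DualPair.eq_hatTransport_baseChange`, §1), which is `Ĝ_K` by the uniqueness of the dual
(★ `IsBaseChangeVia.hat_eq_hatTransport`); hence `ĝ` is a homomorphism and the `λ`-clause holds, both being detected on
the generic fibre (★ `isMonHom_of_isMonHom_genericFibre`, ★ `map_genericFibre_injective`: flat source, separated target,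
[Artin1986NeronModels] (1.1)); the level clause is ★ `LevelStructure.σ_comp_eq_iff_genericFibre`.  This is the valuative
input of the PROPERNESS of the action `PGL × H → H × H` in the construction of the moduli scheme
([MumfordFogartyKirwan1994] Def. 0.10 / Prop. 0.9 p. 16, proof of Prop. 7.6). [cite: MumfordFogartyKirwan1994, Ch. 7 §2 Definition 7.2 (p. 129) and Definition 7.3 (p. 129)]
[cite: BLRNeronModels1990, Prop. 1.2/8] [cite: Artin1986NeronModels, §1 (1.1) (p. 214) and Cor. (1.4) (p. 215)]
[cite: MilneAV2008, I §8 pp. 36–37] -/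
theorem exists_isBaseChangeVia_id_of_genericFibre (P' P : PolarizedAbelianSchemeWithLevel g N δ (Spec (.of R)))
    {G_K : (P'.baseChange (specGenericPoint R K)).A.X.left ⟶ (P.baseChange (specGenericPoint R K)).A.X.left}
    {Ĝ_K : (P'.baseChange (specGenericPoint R K)).D.hat.X.left ⟶ (P.baseChange (specGenericPoint R K)).D.hat.X.left}
    (hK : (P'.baseChange (specGenericPoint R K)).IsBaseChangeVia (P.baseChange (specGenericPoint R K))
      (𝟙 (Spec (.of K))) G_K Ĝ_K) :
    ∃ (f : P'.A.X ≅ P.A.X) (ĝ : P'.D.hat.X ⟶ P.D.hat.X), IsMonHom f.hom ∧ IsMonHom ĝ ∧ IsIso ĝ ∧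
      ((genericFibre R K).map f.hom).left = G_K ∧ ((genericFibre R K).map ĝ).left = Ĝ_K ∧
      P'.IsBaseChangeVia P (𝟙 (Spec (.of R))) f.hom.left ĝ.left := by
  -- Step 1: the `A`-clause over `K` is an isomorphism of `K`-group schemes `eK` with underlying map `G_K`
  obtain ⟨eK, heK, hmonK⟩ := AbelianSchemeOver.exists_iso_of_isBaseChangeVia_id hK.1.1
  subst heK
  haveI : IsMonHom eK.hom := hmonK
  -- Step 2: Néron extension of `eK` to an isomorphism of `R`-group schemes `f : A' ≅ A`
  obtain ⟨f, hf, hfmon, -⟩ := P'.A.exists_iso_map_genericFibre_eq K P.A eK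
  haveI : IsMonHom f.hom := hfmon hmonK
  haveI : IsMonHom f.symm.hom := by change IsMonHom f.inv; infer_instance
  have hfl : ((genericFibre R K).map f.hom).left = eK.hom.left := congrArg CommaMorphism.left hf
  -- `eK` lies over `f`
  have hε : eK.hom.left ≫ pullback.fst P.A.X.hom (specGenericPoint R K) =
      pullback.fst P'.A.X.hom (specGenericPoint R K) ≫ f.hom.left :=
    (congrArg (· ≫ pullback.fst P.A.X.hom (specGenericPoint R K)) hfl).symm.trans
      ((congrArg (· ≫ pullback.fst P.A.X.hom (specGenericPoint R K))
        (Over.pullback_map_left (specGenericPoint R K) P'.A.X (k := f.hom))).trans (pullback.lift_fst _ _ _))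
  -- Step 3: the dual transport `ĝ := Ĥ_f : Â' → Â` over `Spec R` (an isomorphism; Poincaré clause by construction)
  haveI : IsIso (DualPair.hatTransportOver P.D P'.D f) := DualPair.isIso_hatTransportOver P.D P'.D f f.symm rfl
  -- Step 4: its generic fibre is `Ĝ_K` (§1 + uniqueness of the dual over `K`)
  have hĜK : Ĝ_K = DualPair.hatTransport (P.baseChange (specGenericPoint R K)).D
      (P'.baseChange (specGenericPoint R K)).D eK :=
    IsBaseChangeVia.hat_eq_hatTransport eK hK
  have hres : ((genericFibre R K).map (DualPair.hatTransportOver P.D P'.D f)).left =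
      DualPair.hatTransport (P.baseChange (specGenericPoint R K)).D (P'.baseChange (specGenericPoint R K)).D eK :=
    DualPair.eq_hatTransport_baseChange (specGenericPoint R K) P.D P'.D f eK (hεm := hmonK) hε _
      ((congrArg (· ≫ pullback.fst P.D.hat.X.hom (specGenericPoint R K))
        (Over.pullback_map_left (specGenericPoint R K) P'.D.hat.X (k := DualPair.hatTransportOver P.D P'.D f))).trans
          (pullback.lift_fst _ _ _))
      (Over.w ((genericFibre R K).map (DualPair.hatTransportOver P.D P'.D f)))
  have hresK : ((genericFibre R K).map (DualPair.hatTransportOver P.D P'.D f)).left = Ĝ_K := hres.trans hĜK.symm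
  -- Step 5: `ĝ` is a homomorphism of `R`-group schemes (its generic fibre underlies the hat clause over `K`)
  obtain ⟨êK, hêK, hmonK'⟩ := AbelianSchemeOver.exists_iso_of_isBaseChangeVia_id hK.2.1
  have hmapĝ : (genericFibre R K).map (DualPair.hatTransportOver P.D P'.D f) = êK.hom :=
    Over.OverMorphism.ext (hresK.trans hêK.symm)
  haveI : IsMonHom ((genericFibre R K).map (DualPair.hatTransportOver P.D P'.D f)) := by rw [hmapĝ]; exact hmonK'
  haveI : IsMonHom (DualPair.hatTransportOver P.D P'.D f) :=
    AbelianSchemeOver.isMonHom_of_isMonHom_genericFibre K P'.D.hat P.D.hat (DualPair.hatTransportOver P.D P'.D f)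
  -- Step 6: the four clauses over `Spec R`
  have hhat : P'.D.hat.IsBaseChangeVia P.D.hat (𝟙 (Spec (.of R))) (DualPair.hatTransportOver P.D P'.D f).left :=
    isBaseChangeVia_id_of_isMonHom P'.D.hat P.D.hat (DualPair.hatTransportOver P.D P'.D f)
  have hσ : ∀ i, P'.level.σ i ≫ f.hom = P.level.σ i := by
    refine (AbelianSchemeOver.LevelStructure.σ_comp_eq_iff_genericFibre K P'.level P.level f.hom).mpr fun i => ?_
    exact Over.OverMorphism.ext ((Over.comp_left _ _ _ _ _).trans ((congrArg (_ ≫ ·) hfl).trans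
      ((hK.1.2 i).trans (Category.id_comp _))))
  have hlev : P'.level.IsBaseChangeVia P.level (𝟙 (Spec (.of R))) f.hom.left :=
    levelStructure_isBaseChangeVia_id_of_isMonHom P'.level P.level f.hom hσ
  have hlamO : P'.pol.lam ≫ DualPair.hatTransportOver P.D P'.D f = f.hom ≫ P.pol.lam := by
    haveI := P.D.hat.isProper
    haveI := P'.A.isSmooth
    haveI : Flat P'.A.X.hom := inferInstance
    apply map_genericFibre_injective R K P.D.hat.X P'.A.X
    change (genericFibre R K).map (P'.pol.lam ≫ DualPair.hatTransportOver P.D P'.D f) =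
      (genericFibre R K).map (f.hom ≫ P.pol.lam)
    rw [Functor.map_comp, Functor.map_comp]
    exact Over.OverMorphism.ext ((Over.comp_left _ _ _ _ _).trans ((congrArg (_ ≫ ·) hresK).trans
      (hK.2.2.2.trans ((congrArg (· ≫ _) hfl).symm.trans (Over.comp_left _ _ _ _ _).symm))))
  have hlam : P'.pol.lam.left ≫ (DualPair.hatTransportOver P.D P'.D f).left = f.hom.left ≫ P.pol.lam.left :=
    (Over.comp_left _ _ _ _ _).symm.trans ((congrArg CommaMorphism.left hlamO).trans (Over.comp_left _ _ _ _ _))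
  have hP := DualPair.nonempty_pullback_map_hatTransport_iso P.D P'.D f
  exact ⟨f, DualPair.hatTransportOver P.D P'.D f, inferInstance, inferInstance, inferInstance, hfl, hresK,
    hlev, hhat, ⟨_, _, hP⟩, hlam⟩

/-- **Bare form** — the shape quantified by consumers (valuative criterion for the action on the embedded families):
generically isomorphic triples over a Dedekind domain are isomorphic, `∃ G Ĝ, P'.IsBaseChangeVia P (𝟙 (Spec R)) G Ĝ`.
[cite: MumfordFogartyKirwan1994, Ch. 7 §2 Definition 7.2 (p. 129) and Definition 7.3 (p. 129)] [cite: BLRNeronModels1990, Prop. 1.2/8] -/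
theorem exists_isBaseChangeVia_id_of_genericFibre' (P' P : PolarizedAbelianSchemeWithLevel g N δ (Spec (.of R)))
    {G_K : (P'.baseChange (specGenericPoint R K)).A.X.left ⟶ (P.baseChange (specGenericPoint R K)).A.X.left}
    {Ĝ_K : (P'.baseChange (specGenericPoint R K)).D.hat.X.left ⟶ (P.baseChange (specGenericPoint R K)).D.hat.X.left}
    (hK : (P'.baseChange (specGenericPoint R K)).IsBaseChangeVia (P.baseChange (specGenericPoint R K))
      (𝟙 (Spec (.of K))) G_K Ĝ_K) :
    ∃ (G : P'.A.X.left ⟶ P.A.X.left) (Ĝ : P'.D.hat.X.left ⟶ P.D.hat.X.left),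
      P'.IsBaseChangeVia P (𝟙 (Spec (.of R))) G Ĝ := by
  obtain ⟨f, ĝ, -, -, -, -, -, h⟩ := exists_isBaseChangeVia_id_of_genericFibre K P' P hK
  exact ⟨f.hom.left, ĝ.left, h⟩

end PolarizedAbelianSchemeWithLevel

end Literature.AlgebraicGeometry.AbelianSchemes

end
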